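import Mathlib
import Summits.CriticalPhenomena.PercolationContinuityZ3.Theses.PercNonProliferation
import Literature.Probability.Percolation.SharpnessDCTProofs
import HarnessLib

/-!
# Route `PercNonProliferation` — support `PolynomialAssembly` (item `stmt-CriticalPhenomena-4458`)

Settles the route decl
`Summit.CriticalPhenomena.PercolationContinuityZ3.Theses.PercNonProliferation.PolynomialAssembly`:

  `MeanCauchySchwarz → SpanningBKCap → FreeBoxPowerSaving → SubpolynomialBlocking → PercolationContinuityZ3`.

This is the glue of the route's "polynomial pair" (measure-theoretic bookkeeping and real arithmetic,
no percolation input beyond the four hypotheses). Work at `p = p_c(ℤ³)`; write `B(n) = box 3 n`,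
`P = bondPercolation (zdGraph 3) (criticalProbI 3)`, `θ = θ(p_c)`,
`u_n = P(no open path inside B(2n) from B(n) to ∂⁻B(2n))` (the blocking probability), so that the crossing
probability is `1 - u_n` (complement of a finite union of the measurable events `{x ↔ y in B(2n)}`).

* `SpanningBKCap` + geometric series: `E[N_n] = Σ_{k<|B(n)|} P(k+1 spanning representatives)
  ≤ Σ_k (1-u_n)^{k+1} ≤ 1/u_n`;
* `SubpolynomialBlocking` with `s := a/2`: eventually `u_n ≥ n^{-a/2}`, hence `E[N_n] ≤ n^{a/2}`;
* `FreeBoxPowerSaving` at index `2n` and monotonicity of the pair sum in the box: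
  `E[S_n] = Σ_{x,y∈B(n)} P(x ↔ y in B(2n)) ≤ Σ_{x,y∈B(2n)} P(x ↔ y in B(2n)) ≤ C (2n)^{-a} |B(2n)|²
  ≤ 64 C (2n)^{-a} |B(n)|²` (`|B(2n)| = (4n+1)³ ≤ 8 (2n+1)³ = 8 |B(n)|`);
* `MeanCauchySchwarz`: `(θ |B(n)|)² ≤ E[N_n] E[S_n]`, so `θ² ≤ 64 C 2^{-a} n^{-a/2}` eventually, and
  `n^{-a/2} → 0` gives `θ² ≤ 0`, i.e. `θ(p_c) = 0`, which is `PercolationContinuityZ3`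
  (`percolationContinuityZ3_iff`).

The arithmetic is isolated in `polynomialAssembly_arith`; the measure-theoretic steps are stated for an
abstract probability space so that the long event terms of the route file are only ever supplied by
unification.
-/

namespace Summit.CriticalPhenomena.PercolationContinuityZ3.Theorems

open MeasureTheory Filter Topology
open Literature.Probability.Percolation Literature.Probability.LatticeModels
open Summit.CriticalPhenomena.PercolationContinuityZ3.Theses.PercNonProliferation

/-- Truncated geometric series with the exponent shifted by one: for `0 ≤ q < 1`,
`Σ_{k<K} q^{k+1} ≤ 1/(1-q)`. -/
theorem polynomialAssembly_sum_pow_succ_le {q : ℝ} (h0 : 0 ≤ q) (h1 : q < 1) (K : ℕ) :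
    ∑ k ∈ Finset.range K, q ^ (k + 1) ≤ 1 / (1 - q) := by
  calc ∑ k ∈ Finset.range K, q ^ (k + 1) ≤ ∑ k ∈ Finset.range K, q ^ k :=
        Finset.sum_le_sum fun k _ => pow_le_pow_of_le_one h0 h1.le (Nat.le_succ k)
    _ ≤ q ^ 0 / (1 - q) := by
        rw [Finset.range_eq_Ico]
        exact geom_sum_Ico_le_of_lt_one h0 h1
    _ = 1 / (1 - q) := by rw [pow_zero]

/-- The BK cap summed: on a probability space, if `r k ≤ P(Cr)^{k+1}` for every `k` and the
complement of the (measurable) event `Cr` has probability `u > 0`, then `Σ_{k<K} r k ≤ 1/u`. -/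
theorem polynomialAssembly_sum_le_one_div {α : Type*} [MeasurableSpace α] (μ : Measure α)
    [IsProbabilityMeasure μ] {Cr : Set α} (hCr : MeasurableSet Cr) {r : ℕ → ℝ}
    (hr : ∀ k, r k ≤ (μ.real Cr) ^ (k + 1)) {u : ℝ} (hu : μ.real Crᶜ = u) (hu0 : 0 < u)
    (K : ℕ) : ∑ k ∈ Finset.range K, r k ≤ 1 / u := by
  have hq : μ.real Cr = 1 - u := by
    rw [← hu, probReal_compl_eq_one_sub hCr]
    ring
  have hq0 : 0 ≤ μ.real Cr := measureReal_nonneg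
  have hq1 : μ.real Cr < 1 := by
    rw [hq]
    linarith
  calc ∑ k ∈ Finset.range K, r k ≤ ∑ k ∈ Finset.range K, (μ.real Cr) ^ (k + 1) :=
        Finset.sum_le_sum fun k _ => hr k
    _ ≤ 1 / (1 - μ.real Cr) := polynomialAssembly_sum_pow_succ_le hq0 hq1 K
    _ = 1 / u := by rw [hq, sub_sub_cancel]

/-- A doubly-indexed finite union of measurable events, written with bounded existential
quantifiers over two finsets, is measurable. -/
theorem polynomialAssembly_measurableSet_exists₂ {α β γ : Type*} [MeasurableSpace α]
    (s : Finset β) (t : Finset γ) {A : β → γ → Set α}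
    (hA : ∀ x ∈ s, ∀ y ∈ t, MeasurableSet (A x y)) :
    MeasurableSet {ω | ∃ x ∈ s, ∃ y ∈ t, ω ∈ A x y} := by
  have h : {ω | ∃ x ∈ s, ∃ y ∈ t, ω ∈ A x y} = ⋃ x ∈ s, ⋃ y ∈ t, A x y := by
    ext ω
    simp only [Set.mem_setOf_eq, Set.mem_iUnion, exists_prop]
  rw [h]
  exact Finset.measurableSet_biUnion _ fun x hx =>
    Finset.measurableSet_biUnion _ fun y hy => hA x hx y hy

/-- Monotonicity of a double sum of non-negative terms in the (common) index finset. -/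
theorem polynomialAssembly_sum_sum_mono {β : Type*} {s t : Finset β} (h : s ⊆ t)
    {f : β → β → ℝ} (hf : ∀ x y, 0 ≤ f x y) :
    ∑ x ∈ s, ∑ y ∈ s, f x y ≤ ∑ x ∈ t, ∑ y ∈ t, f x y :=
  calc ∑ x ∈ s, ∑ y ∈ s, f x y ≤ ∑ x ∈ s, ∑ y ∈ t, f x y :=
        Finset.sum_le_sum fun x _ => Finset.sum_le_sum_of_subset_of_nonneg h fun y _ _ => hf x y
    _ ≤ ∑ x ∈ t, ∑ y ∈ t, f x y :=
        Finset.sum_le_sum_of_subset_of_nonneg h fun x _ _ => Finset.sum_nonneg fun y _ => hf x y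

/-- The real arithmetic of the polynomial pair at a fixed scale `n ≥ 1`.  Reading `θ` = `θ(p_c)`,
`b = |B(n)|`, `b₂ = |B(2n)|`, `EN = E[N_n]`, `ES = E[S_n]`, `T` = the pair sum over `B(2n)`,
`u = u_n`: from `(θ b)² ≤ EN·ES`, `EN ≤ 1/u`, `u ≥ n^{-a/2}`, `0 ≤ ES ≤ T`, `T/b₂² ≤ C (2n)^{-a}`,
`b₂ ≤ 8 b` one gets `θ² ≤ 64 C 2^{-a} n^{-a/2}`. -/
theorem polynomialAssembly_arith {θ b b₂ EN ES T u C a : ℝ} {n : ℕ} (hn : 1 ≤ n) (hC : 0 ≤ C)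
    (hb : 0 < b) (hb₂ : b₂ ≤ 8 * b) (hb₂0 : 0 < b₂)
    (hMCS : (θ * b) ^ 2 ≤ EN * ES) (hEN : EN ≤ 1 / u) (hu : (n : ℝ) ^ (-(a / 2)) ≤ u)
    (hES0 : 0 ≤ ES) (hES : ES ≤ T) (hT : T / b₂ ^ 2 ≤ C * ((2 * n : ℕ) : ℝ) ^ (-a)) :
    θ ^ 2 ≤ 64 * C * (2 : ℝ) ^ (-a) * (n : ℝ) ^ (-(a / 2)) := by
  have hn0 : (0 : ℝ) < n := Nat.cast_pos.2 (Nat.succ_le_iff.1 hn)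
  have hnpow : 0 < (n : ℝ) ^ (-(a / 2)) := Real.rpow_pos_of_pos hn0 _
  have hu0 : 0 < u := hnpow.trans_le hu
  have hinv : 1 / u ≤ (n : ℝ) ^ (a / 2) := by
    calc 1 / u ≤ 1 / (n : ℝ) ^ (-(a / 2)) := one_div_le_one_div_of_le hnpow hu
      _ = (n : ℝ) ^ (a / 2) := by rw [Real.rpow_neg hn0.le, one_div, inv_inv]
  have h2n : ((2 * n : ℕ) : ℝ) ^ (-a) = (2 : ℝ) ^ (-a) * (n : ℝ) ^ (-a) := by
    rw [Nat.cast_mul, Nat.cast_ofNat]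
    exact Real.mul_rpow (by norm_num) hn0.le
  have hK0 : 0 ≤ C * ((2 : ℝ) ^ (-a) * (n : ℝ) ^ (-a)) :=
    mul_nonneg hC (mul_nonneg (Real.rpow_nonneg (by norm_num) _) (Real.rpow_nonneg hn0.le _))
  have hT' : T ≤ C * ((2 : ℝ) ^ (-a) * (n : ℝ) ^ (-a)) * b₂ ^ 2 := by
    rw [← h2n]
    exact (div_le_iff₀ (pow_pos hb₂0 2)).1 hT
  have hb₂sq : b₂ ^ 2 ≤ 64 * b ^ 2 := by
    calc b₂ ^ 2 ≤ (8 * b) ^ 2 := pow_le_pow_left₀ hb₂0.le hb₂ 2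
      _ = 64 * b ^ 2 := by ring
  have hES' : ES ≤ C * ((2 : ℝ) ^ (-a) * (n : ℝ) ^ (-a)) * (64 * b ^ 2) :=
    hES.trans (hT'.trans (mul_le_mul_of_nonneg_left hb₂sq hK0))
  have hprod : (θ * b) ^ 2 ≤
      (n : ℝ) ^ (a / 2) * (C * ((2 : ℝ) ^ (-a) * (n : ℝ) ^ (-a)) * (64 * b ^ 2)) :=
    hMCS.trans (mul_le_mul (hEN.trans hinv) hES' hES0 (Real.rpow_nonneg hn0.le _))
  have hcomb : (n : ℝ) ^ (a / 2) * (n : ℝ) ^ (-a) = (n : ℝ) ^ (-(a / 2)) := by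
    rw [← Real.rpow_add hn0]
    congr 1
    ring
  have key : θ ^ 2 * b ^ 2 ≤ 64 * C * (2 : ℝ) ^ (-a) * (n : ℝ) ^ (-(a / 2)) * b ^ 2 := by
    calc θ ^ 2 * b ^ 2 = (θ * b) ^ 2 := by ring
      _ ≤ (n : ℝ) ^ (a / 2) * (C * ((2 : ℝ) ^ (-a) * (n : ℝ) ^ (-a)) * (64 * b ^ 2)) := hprod
      _ = 64 * C * (2 : ℝ) ^ (-a) * ((n : ℝ) ^ (a / 2) * (n : ℝ) ^ (-a)) * b ^ 2 := by ring
      _ = 64 * C * (2 : ℝ) ^ (-a) * (n : ℝ) ^ (-(a / 2)) * b ^ 2 := by rw [hcomb]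
  exact le_of_mul_le_mul_right key (pow_pos hb 2)

/-- **Item `stmt-CriticalPhenomena-4458` (`PolynomialAssembly`)**: the glue of the polynomial pair,
`MeanCauchySchwarz → SpanningBKCap → FreeBoxPowerSaving → SubpolynomialBlocking → θ(p_c(ℤ³)) = 0`.
At `p_c` with `s := a/2`: `E[N_n] ≤ Σ_k (1-u_n)^{k+1} ≤ 1/u_n ≤ n^{a/2}`,
`E[S_n] ≤ Σ_{x,y∈B(2n)} P(x ↔ y in B(2n)) ≤ 64 C (2n)^{-a} |B(n)|²`, so
`θ(p_c)² ≤ 64 C 2^{-a} n^{-a/2} → 0`. -/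
theorem polynomialAssembly_proof : PolynomialAssembly := by
  unfold PolynomialAssembly
  intro hMCS hBK hFPS hSB
  unfold MeanCauchySchwarz at hMCS
  unfold SpanningBKCap at hBK
  unfold FreeBoxPowerSaving at hFPS
  unfold SubpolynomialBlocking at hSB
  refine Literature.Probability.Percolation.percolationContinuityZ3_iff.2 ?_
  obtain ⟨a, C, ha, hC⟩ := hFPS
  have ha2 : 0 < a / 2 := half_pos ha
  have hC0 : 0 ≤ C := by
    have h1 := hC 1 le_rfl
    rw [Nat.cast_one, Real.one_rpow, mul_one] at h1
    exact le_trans (by positivity) h1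
  have key : ∀ᶠ n : ℕ in atTop, (theta (zdGraph 3) (0 : Site 3) (criticalProbI 3)) ^ 2 ≤
      64 * C * (2 : ℝ) ^ (-a) * (n : ℝ) ^ (-(a / 2)) := by
    filter_upwards [hSB (a / 2) ha2, eventually_ge_atTop 1] with n hu hn
    have hn0 : (0 : ℝ) < n := Nat.cast_pos.2 (Nat.succ_le_iff.1 hn)
    have hu0 := (Real.rpow_pos_of_pos hn0 (-(a / 2))).trans_le hu
    -- volume doubling: `|B(2n)| = (4n+1)³ ≤ 8 (2n+1)³ = 8 |B(n)|`
    have h8 : ((box 3 (2 * n)).card : ℝ) ≤ 8 * (box 3 n).card := by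
      rw [card_box, card_box]
      have h : (2 * (2 * n) + 1) ^ 3 ≤ 8 * (2 * n + 1) ^ 3 := by
        calc (2 * (2 * n) + 1) ^ 3 ≤ (2 * (2 * n + 1)) ^ 3 := Nat.pow_le_pow_left (by omega) 3
          _ = 8 * (2 * n + 1) ^ 3 := by ring
      exact_mod_cast h
    refine polynomialAssembly_arith hn hC0 ?_ h8 ?_
      (hMCS (criticalProbI 3) n) ?_ hu ?_ ?_ (hC (2 * n) (by omega))
    · exact Nat.cast_pos.2 (Finset.card_pos.2 (box_nonempty 3 n))
    · exact Nat.cast_pos.2 (Finset.card_pos.2 (box_nonempty 3 (2 * n)))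
    · refine polynomialAssembly_sum_le_one_div _ ?_ (fun k => hBK (criticalProbI 3) k n) ?_ hu0 _
      · exact polynomialAssembly_measurableSet_exists₂ _ _ fun x _ y _ =>
          DCT16.measurableSet_openConnIn _ x y
      · rfl
    · positivity
    · exact polynomialAssembly_sum_sum_mono (box_mono 3 (by omega)) fun x y => measureReal_nonneg
  have hlim : Tendsto (fun n : ℕ => 64 * C * (2 : ℝ) ^ (-a) * (n : ℝ) ^ (-(a / 2))) atTop (𝓝 0) := by
    have h := ((tendsto_rpow_neg_atTop ha2).comp tendsto_natCast_atTop_atTop).const_mul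
      (64 * C * (2 : ℝ) ^ (-a))
    rw [mul_zero] at h
    exact h
  have hsq : (theta (zdGraph 3) (0 : Site 3) (criticalProbI 3)) ^ 2 ≤ 0 := ge_of_tendsto hlim key
  exact pow_eq_zero_iff two_ne_zero |>.1 (le_antisymm hsq (sq_nonneg _))

end Summit.CriticalPhenomena.PercolationContinuityZ3.Theorems
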